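import Summits.AtomisticToContinuum.Crystallization.Theorems.ChessboardParticlePlanesPeriodicWindowsStubOffsetLayerDecay

/-!
# Crux `PeriodicWindows` (stmt-AtomisticToContinuum-3240), line `dense-laminar-hull` — stub HC, helper `hc_hollowShells`:
# the hollow shells of the triangular lattice

For the triangular layer lattice `{i v₁(a) + j v₂(a)}` (`v₁ = (a, 0, 0)`, `v₂ = (a/2, a√3/2, 0)`) seen from the hollow
site `-b`, `b = barlowOffset a = (a/2, a√3/6, 0)`, the squared distances are
`‖i v₁ + j v₂ + b‖² = a² Q(i, j)` with the shifted planar form `Q(i, j) = (i + j/2 + 1/2)² + ¾ (j + 1/3)²`.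
On `ℤ²` one has `12 Q(i, j) = 3 (2i + j + 1)² + (3j + 1)²`, an integer; its minimum is `4` (`Q = 1/3`), attained
exactly at the three nearest hollow bonds `(i, j) ∈ {(0,0), (-1,0), (0,-1)}`, and it is `≥ 16` (`Q ≥ 4/3`) at every other
integer point (case analysis on `j ∈ {-1, 0, 1}` versus `|j| ≥ 2`). All elementary. [folklore]
-/

noncomputable section

namespace Summit.AtomisticToContinuum.Crystallization.Theorems.PeriodicWindowsDenseLaminarHull

open Literature.MathematicalPhysics.StatisticalMechanics Filter Metric
open scoped BigOperators

/-- **The integer hollow shells**: for integers `i, j`, either `(i, j)` is one of the three nearest hollow bonds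
`(0,0), (-1,0), (0,-1)`, or `3 (2i + j + 1)² + (3j + 1)² ≥ 16`. [folklore] -/
theorem hho_int_shells (i j : ℤ) :
    ((i, j) = (0, 0) ∨ (i, j) = (-1, 0) ∨ (i, j) = (0, -1)) ∨
      16 ≤ 3 * (2 * i + j + 1) ^ 2 + (3 * j + 1) ^ 2 := by
  rcases le_or_gt 2 j with hj | hj
  · right; nlinarith [sq_nonneg (2 * i + j + 1)]
  rcases le_or_gt j (-2) with hj' | hj'
  · right; nlinarith [sq_nonneg (2 * i + j + 1)]
  interval_cases j
  · -- `j = -1`: `12 i² + 4`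
    by_cases hi : i = 0
    · left; right; right; simp [hi]
    · right
      have h1 : 1 ≤ i ^ 2 := by
        rcases lt_or_gt_of_ne hi with h | h <;> nlinarith
      nlinarith
  · -- `j = 0`: `3 (2i + 1)² + 1`
    by_cases hi : i = 0
    · left; left; simp [hi]
    by_cases hi' : i = -1
    · left; right; left; simp [hi']
    right
    have h9 : 9 ≤ (2 * i + 1) ^ 2 := by
      rcases lt_or_gt_of_ne hi with h | h
      · have h2 : i ≤ -2 := by omega
        nlinarith
      · have h2 : 1 ≤ i := h
        nlinarith
    nlinarith
  · -- `j = 1`: `3 (2i + 2)² + 16`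
    right; nlinarith [sq_nonneg (2 * i + 2)]

/-- **The three nearest hollow bonds** have `3 (2i + j + 1)² + (3j + 1)² = 4`. [folklore] -/
theorem hho_int_nearest {i j : ℤ} (h : (i, j) = (0, 0) ∨ (i, j) = (-1, 0) ∨ (i, j) = (0, -1)) :
    3 * (2 * i + j + 1) ^ 2 + (3 * j + 1) ^ 2 = 4 := by
  simp only [Prod.mk.injEq] at h
  rcases h with ⟨rfl, rfl⟩ | ⟨rfl, rfl⟩ | ⟨rfl, rfl⟩ <;> norm_num

/-- **Squared distances from the hollow site in coordinates**: for `a ≠ 0` and integers `i, j`,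
`‖i v₁ + j v₂ + b‖² = a² ((i + j/2 + 1/2)² + ¾ (j + 1/3)²)`. [folklore] -/
theorem hho_norm_sq {a : ℝ} (ha : a ≠ 0) (i j : ℤ) :
    ‖((i : ℝ)) • triangularVec₁ a + ((j : ℝ)) • triangularVec₂ a + barlowOffset a‖ ^ 2 =
      a ^ 2 * (((i : ℝ) + j / 2 + 1 / 2) ^ 2 + 3 / 4 * ((j : ℝ) + 1 / 3) ^ 2) := by
  have hb2 : (barlowOffset a) 2 = 0 := by simp [barlowOffset]
  have hb0 : (barlowOffset a) 0 = a / 2 := by simp [barlowOffset]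
  have hb1 : (barlowOffset a) 1 = a * √3 / 6 := by simp [barlowOffset]
  rw [(old_norm_sq_horiz ha (barlowOffset a) hb2 (i : ℝ) (j : ℝ)).2, hb0, hb1]
  have h3 : (√3 : ℝ) * √3 = 3 := Real.mul_self_sqrt (by norm_num)
  have hc1 : a / 2 / a = 1 / 2 := by field_simp
  have hc2 : 2 * √3 * (a * √3 / 6) / (3 * a) = 1 / 3 := by
    have h : 2 * √3 * (a * √3 / 6) = a * (√3 * √3) / 3 := by ring
    rw [h, h3, div_eq_iff (mul_ne_zero three_ne_zero ha)]
    ring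
  rw [hc1, hc2]

/-- **The planar form as an integer**: `(i + j/2 + 1/2)² + ¾ (j + 1/3)² = (3 (2i + j + 1)² + (3j + 1)²) / 12`. [folklore] -/
theorem hho_form_eq (i j : ℤ) :
    ((i : ℝ) + j / 2 + 1 / 2) ^ 2 + 3 / 4 * ((j : ℝ) + 1 / 3) ^ 2 =
      ((3 * (2 * i + j + 1) ^ 2 + (3 * j + 1) ^ 2 : ℤ) : ℝ) / 12 := by
  push_cast
  ring

/-- **Stub HC helper `hc_hollowShells`** (the hollow shells of the triangular lattice): for `a > 0` and integers
`i, j`, `‖i v₁ + j v₂ + b‖² = a² ((i + j/2 + 1/2)² + ¾ (j + 1/3)²)`; this is `≥ a²/3`, with equality exactly at the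
three nearest hollow bonds `(i, j) ∈ {(0,0), (-1,0), (0,-1)}`, and `≥ 4a²/3` at every other lattice point. [folklore] -/
theorem hc_hollowShells : ∀ a : ℝ, 0 < a → ∀ i j : ℤ,
    ‖((i : ℝ)) • triangularVec₁ a + ((j : ℝ)) • triangularVec₂ a + barlowOffset a‖ ^ 2 =
      a ^ 2 * (((i : ℝ) + j / 2 + 1 / 2) ^ 2 + 3 / 4 * ((j : ℝ) + 1 / 3) ^ 2) ∧
    a ^ 2 / 3 ≤ ‖((i : ℝ)) • triangularVec₁ a + ((j : ℝ)) • triangularVec₂ a + barlowOffset a‖ ^ 2 ∧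
    (‖((i : ℝ)) • triangularVec₁ a + ((j : ℝ)) • triangularVec₂ a + barlowOffset a‖ ^ 2 = a ^ 2 / 3 ↔
      ((i, j) = (0, 0) ∨ (i, j) = (-1, 0) ∨ (i, j) = (0, -1))) ∧
    (¬ ((i, j) = (0, 0) ∨ (i, j) = (-1, 0) ∨ (i, j) = (0, -1)) →
      4 * a ^ 2 / 3 ≤ ‖((i : ℝ)) • triangularVec₁ a + ((j : ℝ)) • triangularVec₂ a + barlowOffset a‖ ^ 2) := by
  intro a ha i j
  have hnorm := hho_norm_sq ha.ne' i j
  rw [hho_form_eq] at hnorm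
  set N : ℤ := 3 * (2 * i + j + 1) ^ 2 + (3 * j + 1) ^ 2 with hN
  have ha2 : 0 < a ^ 2 := by positivity
  have hshell := hho_int_shells i j
  -- the far shells: `N ≥ 16`
  have hfar : 16 ≤ N → 4 * a ^ 2 / 3 ≤
      ‖((i : ℝ)) • triangularVec₁ a + ((j : ℝ)) • triangularVec₂ a + barlowOffset a‖ ^ 2 := by
    intro h16
    have h16' : (16 : ℝ) ≤ (N : ℝ) := by exact_mod_cast h16
    rw [hnorm]
    nlinarith
  -- the nearest shell: `N = 4`
  have hnear : ((i, j) = (0, 0) ∨ (i, j) = (-1, 0) ∨ (i, j) = (0, -1)) →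
      ‖((i : ℝ)) • triangularVec₁ a + ((j : ℝ)) • triangularVec₂ a + barlowOffset a‖ ^ 2 = a ^ 2 / 3 := by
    intro h
    have h4 : N = 4 := hho_int_nearest h
    rw [hnorm, h4]
    push_cast
    ring
  refine ⟨by rw [hnorm, hho_form_eq], ?_, ⟨fun heq => ?_, hnear⟩, fun hnot => ?_⟩
  · rcases hshell with h | h
    · rw [hnear h]
    · linarith [hfar h]
  · rcases hshell with h | h
    · exact h
    · have := hfar h
      rw [heq] at this
      nlinarith
  · rcases hshell with h | h
    · exact absurd h hnot
    · exact hfar h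

end Summit.AtomisticToContinuum.Crystallization.Theorems.PeriodicWindowsDenseLaminarHull

end
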